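import Literature.Computability.AlgebraicComplexity.TensorSemiringSpectrum
import Literature.Computability.AlgebraicComplexity.StrassenPreorderSubrank
import Literature.Computability.AlgebraicComplexity.StrassenSpectralTheorem
import Literature.Computability.AlgebraicComplexity.FlatteningRankCube
import Literature.Computability.AlgebraicComplexity.AsymptoticSpectrumProofs
import HarnessLib

/-!
# Strassen duality for the asymptotic subrank of tensors: `Q̃(t) = min_{ξ ∈ Δ(T)} ξ(t)`

Topic `Literature/Computability/AlgebraicComplexity`; DISCHARGE of the named fact
`strassen_duality_asymptoticSubrank K` of `AsymptoticSpectrum.lean` (Christandl–Vrana–Zuiddam,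
JAMS 36 (2023), Prop. 1.6 = Strassen 1988, Thm. 3.8: for the semiring `T` of tensors,
`Q̃(a) = min_{ξ ∈ Δ} ξ(a)`), for every field `K`: `strassen_duality_asymptoticSubrank_holds`.

## The printed claim and the proof architecture

CVZ Prop. 1.6: "Let `S ⊆ T` be a semiring. Let `(Δ, φ)` be an asymptotic spectrum of `S`. Let
`a ∈ S`. Then `Q̃(a) = min_{ξ ∈ Δ} φ(a)(ξ)` and `R̃(a) = max_{ξ ∈ Δ} φ(a)(ξ)`", "which follows from
Theorem 1.1 [the spectral theorem] (see [Strassen 1988])". The general (semiring) form is Zuiddam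
2018, Cor. 2.14, whose hypothesis is `∃ k, a^k ≥ 2`; it is in the tree as
`IsStrassenPreorder.exists_spectralPoint_apply_eq_asympSubrankOf` (`StrassenPreorderSubrank.lean`),
proved modulo the hard direction of the spectral theorem (Zuiddam Thm. 2.12), which is
`IsStrassenPreorder.asympLe_of_forall_spectralPoint` (`StrassenSpectralTheorem.lean`). This file
assembles the TENSOR statement:

* `T(K) = TensorClass K` is a Strassen-preordered commutative semiring and universal spectral
  points are exactly its spectral points (`TensorSemiring.lean`, `TensorSemiringSpectrum.lean`);
  the abstract `Q`, `Q̃` of `[t]` are the tree's `subrank K t`, `asymptoticSubrank K t`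
  (`TensorClass.subrankOf_mk`, `TensorClass.asympSubrankOf_mk`).
* First conjunct `Q̃(t) ≤ F(t)`: the easy half (`IsSpectralPoint.asympSubrankOf_le`).
* Second conjunct, a **trichotomy** special to tensors (cf. Zuiddam 2019, proof of Thm. 1.1 for
  graphs: `G = K₀`, or `K₁ ≤ G ≤ K₁`, or `G ≥ K̄₂`):
  (i) all three flattening ranks of `t` are `≥ 2`: then `2 ≤ [t]^3` (`FlatteningRankCube.lean`)
  and Cor. 2.14 applies; (ii) otherwise some gauge point `ζ⁽ⁱ⁾` (a universal spectral point,
  `AsymptoticSpectrumProofs.lean`) takes the value `≤ 1` at `t`, and `Q̃(t) = ζ⁽ⁱ⁾(t) ∈ {0, 1}`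
  (`= 1` if `t ≠ 0` since `t ≥ ⟨1⟩`, `= 0` if `t = 0`).

## Main statements

* `strassen_duality_asymptoticSubrank_of_spectralTheorem K hspec` — CVZ Prop. 1.6 (subrank) for
  all 3-tensors over the field `K`, from the hard direction `hspec` of Strassen's spectral theorem
  for `T(K)` (Zuiddam Thm. 2.12: `(∀ φ ∈ X, φ(a) ≤ φ(b)) ⇒ a ≲ b`), kept as an explicit
  hypothesis to display the dependency;
* `strassen_duality_asymptoticSubrank_holds K : strassen_duality_asymptoticSubrank K` — the named
  fact, unconditionally (`hspec` supplied by `StrassenSpectralTheorem.lean`).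

## References

* M. Christandl, P. Vrana, J. Zuiddam, *Universal points in the asymptotic spectrum of tensors*,
  J. Amer. Math. Soc. 36 (2023), Prop. 1.6, §1.2. [ChristandlVranaZuiddam2023]
* J. Zuiddam, PhD thesis (2018), Thm. 2.12, Cor. 2.14. [Zuiddam2018]
* V. Strassen, J. reine angew. Math. 384 (1988), Thm. 3.8. [Strassen1988]
-/

noncomputable section

open scoped BigOperators
open Module Submodule

namespace Literature.Computability.AlgebraicComplexity

universe u

/-! ## The abstract `Q`, `Q̃` on `T(K)` are the tensor `Q`, `Q̃` -/

namespace TensorClass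

variable {K : Type u} [Field K]
variable {ι κ μ : Type} [Fintype ι] [Fintype κ] [Fintype μ]

/-- `Q([t]) = Q(t)`: the abstract subrank of the class is the subrank of the tensor. [cite: Zuiddam2018, §2.8] -/
theorem subrankOf_mk (t : ι → κ → μ → K) :
    subrankOf (fun x y : TensorClass K => x ≤ y) (mk t) = subrank K t := by
  unfold subrankOf subrank
  congr 1
  ext s
  simp only [Set.mem_setOf_eq, natCast_eq_mk, mk_le_mk_iff]

/-- `Q̃([t]) = Q̃(t)`: the abstract asymptotic subrank of the class is the asymptotic subrank of
the tensor (both are `sup_N Q((·)^{N+1})^{1/(N+1)}`, and `[t]^N = [t^{⊗N}]`). [cite: Zuiddam2018, §2.8] -/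
theorem asympSubrankOf_mk (t : ι → κ → μ → K) :
    asympSubrankOf (fun x y : TensorClass K => x ≤ y) (mk t) = asymptoticSubrank K t := by
  unfold asympSubrankOf asymptoticSubrank
  congr 1
  funext N
  rw [mk_pow, subrankOf_mk]

end TensorClass

/-! ## Flattening rank zero means the tensor is zero -/

section Zero

variable {K : Type u} [Field K]
variable {ι κ μ : Type*}

/-- A tensor with `ζ⁽¹⁾(t) = 0` is zero (all slices vanish). [folklore] -/
theorem eq_zero_of_flatteningRank_eq_zero [Finite κ] [Finite μ] {t : ι → κ → μ → K}
    (h : flatteningRank t = 0) : t = 0 := by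
  unfold flatteningRank at h
  rw [Submodule.finrank_eq_zero, Submodule.span_eq_bot] at h
  funext a b c
  exact congrFun (h (xSlices t a) ⟨a, rfl⟩) (b, c)

/-- A non-zero tensor has `ζ⁽¹⁾(t) ≥ 1`. [folklore] -/
theorem one_le_flatteningRank [Finite κ] [Finite μ] {t : ι → κ → μ → K} (ht : t ≠ 0) :
    1 ≤ flatteningRank t :=
  Nat.one_le_iff_ne_zero.2 fun h => ht (eq_zero_of_flatteningRank_eq_zero h)

end Zero

/-! ## The duality, given the spectral theorem -/

section Duality

variable (K : Type u) [Field K]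

/-- **Strassen duality for the asymptotic subrank, from the spectral theorem** (CVZ 2023,
Prop. 1.6 = Strassen 1988, Thm. 3.8: `Q̃(t) = min_{ξ ∈ Δ(T)} ξ(t)`; Zuiddam 2018, Cor. 2.14), for
all 3-tensors over a field `K`, GIVEN the hard direction `hspec` of the spectral theorem for the
semiring `T(K)` (Zuiddam Thm. 2.12). Proof: easy half for the bound; for attainment, either all
flattening ranks are `≥ 2` (then `2 ≤ [t]^3` and Cor. 2.14 applies in `T(K)`), or a gauge point
attains `Q̃(t) ∈ {0, 1}`. [cite: ChristandlVranaZuiddam2023, Prop. 1.6] -/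
theorem strassen_duality_asymptoticSubrank_of_spectralTheorem
    (hspec : ∀ a b : TensorClass K,
      (∀ φ, IsSpectralPoint (fun x y : TensorClass K => x ≤ y) φ → φ a ≤ φ b) →
        AsympLe (fun x y : TensorClass K => x ≤ y) a b) :
    strassen_duality_asymptoticSubrank K := by
  intro ι κ μ _ _ _ t
  have h := TensorClass.isStrassenPreorder K
  -- the easy half, for every universal spectral point
  have easy : ∀ F, IsUniversalSpectralPoint K F → asymptoticSubrank K t ≤ F t := by
    intro F hF
    rw [← TensorClass.asympSubrankOf_mk, ← TensorClass.eval_mk hF t]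
    exact (TensorClass.isSpectralPoint_eval hF).asympSubrankOf_le h (TensorClass.mk t)
  refine ⟨easy, ?_⟩
  by_cases hk : ∃ k, (2 : TensorClass K) ≤ TensorClass.mk t ^ k
  · -- Cor. 2.14 in `T(K)`
    obtain ⟨φ, hφ, hφt⟩ :=
      h.exists_spectralPoint_apply_eq_asympSubrankOf hspec h.exists_isSpectralPoint hk
    refine ⟨TensorClass.spectralMapOf φ, TensorClass.isUniversalSpectralPoint_spectralMapOf hφ, ?_⟩
    rw [TensorClass.spectralMapOf_apply, hφt, TensorClass.asympSubrankOf_mk]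
  · -- some flattening rank is `≤ 1`: a gauge point attains `Q̃(t)`
    have hnot : ¬ (2 ≤ flatteningRank t ∧ 2 ≤ flatteningRank (fun b a c => t a b c) ∧
        2 ≤ flatteningRank (fun c a b => t a b c)) := fun H =>
      hk ⟨3, TensorClass.two_le_mk_pow_three t H.1 H.2.1 H.2.2⟩
    obtain ⟨hg₁, hg₂, hg₃⟩ := gaugePoint_isUniversalSpectralPoint_holds K
    -- the value of `Q̃(t)`: `0` if `t = 0`, `1` otherwise
    by_cases ht : t = 0
    · subst ht
      refine ⟨gaugePoint₁ K, hg₁, ?_⟩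
      refine le_antisymm ?_ (easy _ hg₁)
      rw [gaugePoint₁_zero, ← TensorClass.asympSubrankOf_mk]
      exact h.asympSubrankOf_nonneg _
    have hone : (1 : ℝ) ≤ asymptoticSubrank K t := by
      rw [← TensorClass.asympSubrankOf_mk]
      refine le_trans ?_ (h.subrankOf_rpow_le_asympSubrankOf (TensorClass.mk t) 0)
      have h1 : 1 ≤ subrankOf (fun x y : TensorClass K => x ≤ y) (TensorClass.mk t ^ (0 + 1)) := by
        rw [zero_add, pow_one]
        exact h.le_subrankOf_of_le (by simpa using TensorClass.one_le_mk ht)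
      have : ((0 : ℕ) : ℝ) + 1 = 1 := by norm_num
      rw [this, inv_one, Real.rpow_one]
      exact_mod_cast h1
    -- a gauge point with value `≤ 1` at `t` has value exactly `Q̃(t) = 1`
    have finish : ∀ F, IsUniversalSpectralPoint K F → F t ≤ 1 →
        ∃ F, IsUniversalSpectralPoint K F ∧ F t = asymptoticSubrank K t := fun F hF hF1 =>
      ⟨F, hF, le_antisymm (hF1.trans hone) (easy F hF)⟩
    simp only [not_and_or, not_le] at hnot
    rcases hnot with h₁ | h₂ | h₃
    · refine finish _ hg₁ ?_
      rw [gaugePoint₁_eq]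
      exact_mod_cast Nat.lt_succ_iff.1 h₁
    · refine finish _ hg₂ ?_
      rw [gaugePoint₂_eq_gaugePoint₁_swap, gaugePoint₁_eq]
      exact_mod_cast Nat.lt_succ_iff.1 h₂
    · refine finish _ hg₃ ?_
      rw [gaugePoint₃_eq_gaugePoint₁_swap, gaugePoint₁_eq]
      exact_mod_cast Nat.lt_succ_iff.1 h₃

/-- **Strassen duality for the asymptotic subrank** — DISCHARGE of the named fact
`strassen_duality_asymptoticSubrank K` of `AsymptoticSpectrum.lean` (Christandl–Vrana–Zuiddam
2023, Prop. 1.6 = Strassen 1988, Thm. 3.8): for every 3-tensor `t` over the field `K` (finite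
index types), `Q̃(t) = min_{ξ ∈ Δ(T)} ξ(t)` — every universal spectral point is at least the
asymptotic subrank at `t`, and the minimum is attained. Strassen's spectral theorem
(`StrassenSpectralTheorem.lean`) supplies the hypothesis of
`strassen_duality_asymptoticSubrank_of_spectralTheorem`. [cite: ChristandlVranaZuiddam2023, Prop. 1.6] -/
theorem strassen_duality_asymptoticSubrank_holds : strassen_duality_asymptoticSubrank K :=
  strassen_duality_asymptoticSubrank_of_spectralTheorem K fun a b hab =>
    (TensorClass.isStrassenPreorder K).asympLe_of_forall_spectralPoint a b hab

end Duality

end Literature.Computability.AlgebraicComplexity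

end
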